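import Summits.QuantumFields.Balaban3D.Proofs.Transport48

/-!
# `Summit.QuantumFields.Balaban3D.Proofs.FibreFormula` — the renormalization transform as a FIBRE INTEGRAL: for an averaging
# `Ū` whose fibres are parametrised measure-preservingly (`Φ : (V, r) ↦ U`, `Φ_*(dV ⊗ κ) = dU`, `Ū(Φ(V, r)) = V`), the
# Radon–Nikodym transport of every integrable density is `(Tρ)(V) = ∫ ρ(Φ(V, r)) dκ(r)` dV-a.e. — the form in which
# [Balaban1985UV3]'s fibre manipulations (10)–(22) p. 258–261 / (49)–(55) p. 268–269 («∫dU δ(ŪV^{−1}) δ_{Ax}(U) …», «∫dV_k↾_{B(Λ_{k+1})}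
# δ(V̄_kV^{−1}) …») can be carried out pointwise in `V` — lane `pub-balaban3d`, seat p4 (tool for the (β) residuals `hfibre` /
# `hfibreLow` of `…Proofs.Bound55Tower`)

HONEST FRAMING (lane PLAN.md §0, binding): see `…Proofs.SectAFirstStep`.  [folklore] measure theory (Fubini + uniqueness of the
transform, seat p4's `RTAlgebra.IsRT.ae_eq`); nothing of the paper is asserted.  The parametrisation `Φ` for the lane's axial
averaging (per coarse bond `c`: the first `L − 1` bond variables of the line of `c` free, the last one solved from `U(Γ_c) = V(c)` —
a measure-preserving change of variables by the translation invariance of Haar measure; all other bonds free) is the carrier seat's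
to supply; this file is agnostic of it.

WHAT THIS FILE PROVES (no `sorry`, axioms standard): `avgAC_of_fibreParam` (such a `Ū` is Haar-compatible, `Ū_*(dU) = dV`, hence
`AvgAC`), `isRT_fibreIntegral` (the fibre integral IS a renormalization transform of `ρ` in the push-forward reading `Setup.IsRT`),
**`rnTransport_ae_eq_fibreIntegral`** (`rnTransport Ū ρ = ∫ ρ(Φ(·, r)) dκ(r)` dV-a.e.).
-/

noncomputable section

namespace Summit.QuantumFields.Balaban3D.Proofs.FibreFormula

open _root_.MeasureTheory
open Literature.MathematicalPhysics.QuantumFieldTheory.Balaban1983to89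
open Literature.MathematicalPhysics.QuantumFieldTheory.Balaban1983to89.AveragingRT (rnTransport)
open Summit.QuantumFields.Balaban3D.Carriers (AvgAC isRT_rnTransport_of_ac integrable_rnTransport)
open Summit.QuantumFields.Balaban3D.Proofs.RTAlgebra

variable {P : Params} {j : ℕ} {G : Type*} [GaugeGroup G] [MeasurableSpace G] [HaarData G]
  {R : Type*} [MeasurableSpace R] (κ : Measure R) [IsProbabilityMeasure κ]
  {avg : GaugeField P j G → GaugeField P (j + 1) G}
  (Φ : GaugeField P (j + 1) G × R → GaugeField P j G)

/-- A FIBRE PARAMETRISATION of the averaging `Ū`: a measurable `Φ : (V, r) ↦ U` from (coarse field) × (fibre variables with a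
probability law `κ`) that pushes `dV ⊗ κ` to `dU` and lands in the fibre, `Ū(Φ(V, r)) = V`. [folklore] -/
structure IsFibreParam : Prop where
  measurable_avg : Measurable avg
  measurable : Measurable Φ
  map_eq : ((fieldMeasure P (j + 1) G).prod κ).map Φ = fieldMeasure P j G
  avg_apply : ∀ V r, avg (Φ (V, r)) = V

variable {κ Φ}

/-- An averaging with a fibre parametrisation is Haar-compatible: `Ū_*(dU) = dV`. [folklore] -/
theorem map_avg_of_fibreParam (h : IsFibreParam κ Φ (avg := avg)) :
    (fieldMeasure P j G).map avg = fieldMeasure P (j + 1) G := by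
  have hcomp : avg ∘ Φ = Prod.fst := funext fun ⟨V, r⟩ => h.avg_apply V r
  rw [← h.map_eq, Measure.map_map h.measurable_avg h.measurable, hcomp, Measure.map_fst_prod, measure_univ, one_smul]

/-- Hence `AvgAC Ū` (seat p1's binder D-1a holds for such an averaging). [folklore] -/
theorem avgAC_of_fibreParam (h : IsFibreParam κ Φ (avg := avg)) : AvgAC avg :=
  AvgAC.of_map_eq h.measurable_avg (map_avg_of_fibreParam h)

/-- The fibre integral `V ↦ ∫ ρ(Φ(V, r)) dκ(r)` of an integrable density is integrable on the coarse lattice (Fubini). [folklore] -/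
theorem integrable_fibreIntegral (h : IsFibreParam κ Φ (avg := avg)) (ρ : Density P j G)
    (hρ : Integrable ρ (fieldMeasure P j G)) :
    Integrable (fun V => ∫ r, ρ (Φ (V, r)) ∂κ) (fieldMeasure P (j + 1) G) := by
  have hmp : MeasurePreserving Φ ((fieldMeasure P (j + 1) G).prod κ) (fieldMeasure P j G) := ⟨h.measurable, h.map_eq⟩
  have hcomp : Integrable (ρ ∘ Φ) ((fieldMeasure P (j + 1) G).prod κ) :=
    (hmp.integrable_comp hρ.aestronglyMeasurable).mpr hρ
  exact hcomp.integral_prod_left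

/-- **The fibre integral IS a renormalization transform** (push-forward reading `Setup.IsRT`, [Balaban1985Averaging] (10) p. 19
«(Tρ)(V) = ∫dU δ(ŪV^{−1}) ρ(U)»): `∫dV [∫ρ(Φ(V,r))dκ(r)] f(V) = ∫dU ρ(U) f(Ū)` for bounded measurable `f` — Fubini on `dV ⊗ κ`, then
the change of variables `Φ`. [folklore] -/
theorem isRT_fibreIntegral (h : IsFibreParam κ Φ (avg := avg)) (ρ : Density P j G) (hρ : Integrable ρ (fieldMeasure P j G)) :
    IsRT avg ρ (fun V => ∫ r, ρ (Φ (V, r)) ∂κ) := by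
  intro f hf hfC
  obtain ⟨C, hC⟩ := hfC
  have hmp : MeasurePreserving Φ ((fieldMeasure P (j + 1) G).prod κ) (fieldMeasure P j G) := ⟨h.measurable, h.map_eq⟩
  -- the integrand `ρ·(f∘Ū)` on the fine lattice and its pull-back along `Φ`
  have hint : Integrable (fun U => ρ U * f (avg U)) (fieldMeasure P j G) :=
    integrable_mul_test_comp hρ h.measurable_avg hf hC
  have hpull : Integrable ((fun U => ρ U * f (avg U)) ∘ Φ) ((fieldMeasure P (j + 1) G).prod κ) :=
    (hmp.integrable_comp hint.aestronglyMeasurable).mpr hint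
  have hpull' : Integrable (fun z : GaugeField P (j + 1) G × R => ρ (Φ z) * f z.1) ((fieldMeasure P (j + 1) G).prod κ) := by
    refine hpull.congr (Filter.Eventually.of_forall fun z => ?_)
    obtain ⟨V, r⟩ := z
    show ρ (Φ (V, r)) * f (avg (Φ (V, r))) = ρ (Φ (V, r)) * f V
    rw [h.avg_apply]
  calc ∫ V, (∫ r, ρ (Φ (V, r)) ∂κ) * f V ∂(fieldMeasure P (j + 1) G)
      = ∫ V, ∫ r, ρ (Φ (V, r)) * f V ∂κ ∂(fieldMeasure P (j + 1) G) := by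
        refine integral_congr_ae (Filter.Eventually.of_forall fun V => ?_)
        exact (integral_mul_const (f V) _).symm
    _ = ∫ z, ρ (Φ z) * f z.1 ∂((fieldMeasure P (j + 1) G).prod κ) := (integral_prod _ hpull').symm
    _ = ∫ z, ((fun U => ρ U * f (avg U)) ∘ Φ) z ∂((fieldMeasure P (j + 1) G).prod κ) := by
        refine integral_congr_ae (Filter.Eventually.of_forall fun z => ?_)
        obtain ⟨V, r⟩ := z
        show ρ (Φ (V, r)) * f V = ρ (Φ (V, r)) * f (avg (Φ (V, r)))
        rw [h.avg_apply]
    _ = ∫ U, ρ U * f (avg U) ∂(fieldMeasure P j G) := by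
        rw [← h.map_eq, integral_map h.measurable.aemeasurable]
        · rfl
        · rw [h.map_eq]; exact hint.aestronglyMeasurable

/-- **THE FIBRE FORMULA** for the Radon–Nikodym transport (`AveragingRT.rnTransport`, the lane's `T`): for an averaging with a fibre
parametrisation `Φ` and every integrable density `ρ`, `(Tρ)(V) = ∫ ρ(Φ(V, r)) dκ(r)` for dV-almost every `V` (both are transforms of
`ρ`; uniqueness a.e., seat p4's `RTAlgebra.IsRT.ae_eq`).  With it the (β) fibre inequalities `hfibre`/`hfibreLow` of
`…Proofs.Bound55Tower` become inequalities between explicit finite-dimensional Haar integrals, pointwise in `V` — the form in which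
(12)–(22) p. 259–261 and (50)–(55) p. 268–269 are printed. [cite: Balaban1985UV3, (10) p.258 + (49) p.268] -/
theorem rnTransport_ae_eq_fibreIntegral (h : IsFibreParam κ Φ (avg := avg)) (ρ : Density P j G)
    (hρ : Integrable ρ (fieldMeasure P j G)) :
    rnTransport avg ρ =ᵐ[fieldMeasure P (j + 1) G] fun V => ∫ r, ρ (Φ (V, r)) ∂κ :=
  IsRT.ae_eq (isRT_rnTransport_of_ac (avgAC_of_fibreParam h) ρ hρ) (isRT_fibreIntegral h ρ hρ) h.measurable_avg hρ
    (integrable_rnTransport avg ρ hρ) (integrable_fibreIntegral h ρ hρ)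

/-- Consequence for INEQUALITIES (the shape of `hfibre`): to bound `T ρ₁ ≤ T ρ₂ · B` dV-a.e. it suffices to compare the fibre
integrals pointwise, `∫ ρ₁(Φ(V,r)) dκ ≤ (∫ ρ₂(Φ(V,r)) dκ)·B(V)` for a.e. `V`. [folklore] -/
theorem rnTransport_le_mul_of_fibreIntegral (h : IsFibreParam κ Φ (avg := avg)) {ρ₁ ρ₂ : Density P j G}
    (h₁ : Integrable ρ₁ (fieldMeasure P j G)) (h₂ : Integrable ρ₂ (fieldMeasure P j G)) (B : Density P (j + 1) G)
    (hle : ∀ᵐ V ∂(fieldMeasure P (j + 1) G), ∫ r, ρ₁ (Φ (V, r)) ∂κ ≤ (∫ r, ρ₂ (Φ (V, r)) ∂κ) * B V) :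
    rnTransport avg ρ₁ ≤ᵐ[fieldMeasure P (j + 1) G] fun V => rnTransport avg ρ₂ V * B V := by
  filter_upwards [rnTransport_ae_eq_fibreIntegral h ρ₁ h₁, rnTransport_ae_eq_fibreIntegral h ρ₂ h₂, hle] with V e₁ e₂ hV
  rw [e₁, e₂]
  exact hV

end Summit.QuantumFields.Balaban3D.Proofs.FibreFormula

end
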